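import Summits.CriticalPhenomena.PercolationContinuityZ3.Theorems.PercNearOneGluingNoHeavyQuantDepthOneTripleGeneric
import Summits.CriticalPhenomena.PercolationContinuityZ3.Theorems.PercNearOneGluingNoHeavyQuantGluedPairSDECForests
import HarnessLib

/-!
# QUANT lane R8, T-DEC: THE ORACLE-FREE WIDTH-3 DEPTH-1 FAMILIES ON THE NODE'S BINDER — heavy-single triples at the true floor and
# identical triples at `q²y`, each extended by any number of blob-hull-reducible and tame siblings (prim-quant-census-2 gen 79)

builds on p205010 (kernel theorem, internal audit signed; external expert review pending)

Support file (`--supports stmt-CriticalPhenomena-4575`), QUANT lane census seat prim-quant-census-2 (gen 79); memo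
`run/shared/lean/prim/quant/prim-quant-census-2-g79/GLUEDPAIR-G79.md` §6.  Theorems only, standard axioms, no sorries, no definitions.  Assembly of
`…QuantDepthOneTripleHeavySingle` / `…QuantDepthOneTripleGeneric` (the cores) with `sdec_append_reducible` / `sdec_append_tame`
(`…QuantGluedPairSDECForests`, `…QuantResidueForestsAll`).

* `lawOK_aff_three` — law facts / affordability of the three core records.
* **`sdec_flaw_heavySingleCore`** — `L = Lt ++ (Lr ++ [s₃, s₂, s₁])`: a heavy-single balanced triple of depth-1 siblings (`…heavySingle` hypotheses, true
  floor) + reducible `Lr` + tame `Lt` ⟹ `SDEC x (ftop L) (flaw L)`.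
* **`sdec_flaw_three_identical`** / **`sdec_flaw_identicalTripleCore`** — three copies of one depth-1 sibling record (floor `x ≤ q²·y`) (+ `Lr`, `Lt`).

HONEST STATUS.  Families, not the node; `SiblingStep`, `FarTreeRow` OPEN; RATE class (log\*) / honest sentence of `run/shared/lean/prim/quant/README.md`
unchanged.  [this work].  Nothing here is cited as a published result.  The gluing rows served [cite: KozmaNitzan2024, Conjecture 3 (p. 15)]; product
measure [cite: Grimmett1999, §1.3 p. 10].
-/

noncomputable section

open scoped BigOperators

namespace Summit.CriticalPhenomena.PercolationContinuityZ3.Theorems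
namespace Quant
namespace LawDec

open Finset

/-- forest law of three records: `flaw [s₃, s₂, s₁] = (gate ρ₁ q₁ ∗ gate ρ₂ q₂) ∗ gate ρ₃ q₃` and `ftop = M₁ + M₂ + M₃` (for `ρ₁` vanishing above `M₁`).
[this work] -/
theorem flaw_three_eq (s₁ s₂ s₃ : Sib) (h₁M : ∀ h, s₁.M < h → s₁.ρ h = 0) :
    flaw [s₃, s₂, s₁] = lconv (s₁.M + s₂.M) s₃.M (lconv s₁.M s₂.M (gate s₁.ρ s₁.q) (gate s₂.ρ s₂.q)) (gate s₃.ρ s₃.q) ∧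
      ftop [s₃, s₂, s₁] = s₁.M + s₂.M + s₃.M := by
  have e₁ : flaw [s₁] = gate s₁.ρ s₁.q := by
    funext h
    show lconv 0 s₁.M (fun i => if i = 0 then (1 : ℝ) else 0) (gate s₁.ρ s₁.q) h = gate s₁.ρ s₁.q h
    refine lconv_delta_left 0 s₁.M _ (fun k hk => ?_) h
    rw [gate_apply, h₁M k hk, if_neg (by omega)]
    ring
  have e₂ : flaw [s₂, s₁] = lconv s₁.M s₂.M (gate s₁.ρ s₁.q) (gate s₂.ρ s₂.q) := by
    show lconv (ftop [s₁]) s₂.M (flaw [s₁]) (gate s₂.ρ s₂.q) = _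
    rw [e₁]; simp [ftop]
  refine ⟨?_, by simp [ftop]⟩
  show lconv (ftop [s₂, s₁]) s₃.M (flaw [s₂, s₁]) (gate s₃.ρ s₃.q) = _
  rw [e₂]; simp [ftop]

/-- **HEAVY-SINGLE DEPTH-1 TRIPLE + REDUCIBLE + TAME SIBLINGS ⟹ SDEC, NO ORACLE** (the triple's hypotheses as in
`sdec_three_heavySingle_of_subBlobHull`; `Lr` law-OK affordable with gated laws in the blob hull at `x`; `Lt` law-OK affordable tame). [this work] -/
theorem sdec_flaw_heavySingleCore {x : ℝ} (hx0 : 0 < x) (s₁ s₂ s₃ : Sib) {y₁ y₂ y₃ R₁ R₂ R₃ : ℝ}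
    (hy₁0 : 0 < y₁) (hy₁1 : y₁ < 1) (hy₂0 : 0 < y₂) (hy₂1 : y₂ < 1) (hy₃0 : 0 < y₃) (hy₃1 : y₃ < 1)
    (hρ₁ : InBlobHull y₁ R₁ s₁.M s₁.ρ) (hρ₂ : InBlobHull y₂ R₂ s₂.M s₂.ρ) (hρ₃ : InBlobHull y₃ R₃ s₃.M s₃.ρ)
    (hta₁ : y₁ * (s₁.M : ℝ) ≤ R₁) (hta₂ : y₂ * (s₂.M : ℝ) ≤ R₂) (hta₃ : y₃ * (s₃.M : ℝ) ≤ R₃) (hR₁0 : 0 < R₁) (hR₂0 : 0 < R₂)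
    (hq₂0 : 0 < s₂.q) (hq₂₁ : s₂.q ≤ s₁.q) (hq₁1 : s₁.q < 1) (hq₃0 : 0 < s₃.q) (hq₃1 : s₃.q < 1)
    (hQq₃ : s₁.q + s₂.q - s₁.q * s₂.q ≤ s₃.q) (hbal₁ : s₁.q * R₁ + s₂.q * R₂ ≤ s₃.q * R₁) (hbal₂ : s₁.q * R₁ + s₂.q * R₂ ≤ s₃.q * R₂)
    (hx₁ : x ≤ s₁.q * y₁) (hx₂ : x ≤ s₂.q * y₂) (hx₃ : x ≤ s₃.q * y₃)
    (Lr : List Sib) (hLr : ∀ s ∈ Lr, s.LawOK) (hxLr : ∀ s ∈ Lr, x * (s.M : ℝ) ≤ s.q * s.mean)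
    (hred : ∀ s ∈ Lr, ∃ m : ℝ, InBlobHull x m s.M (gate s.ρ s.q))
    (Lt : List Sib) (hLt : ∀ s ∈ Lt, s.LawOK) (hxLt : ∀ s ∈ Lt, x * (s.M : ℝ) ≤ s.q * s.mean)
    (htame : ∀ s ∈ Lt, ∀ h : ℕ, 1 ≤ h → s.ρ h ≠ 0 → s.q * s.mean ≤ 2 * h ∨ x * ((s.M : ℝ) - h) ≤ s.q * s.mean - h) :
    SDEC x (ftop (Lt ++ (Lr ++ [s₃, s₂, s₁]))) (flaw (Lt ++ (Lr ++ [s₃, s₂, s₁]))) := by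
  have hq₁0 : 0 < s₁.q := lt_of_lt_of_le hq₂0 hq₂₁
  have hS := sdec_flaw_three_heavySingle hx0 s₁ s₂ s₃ hy₁0 hy₁1 hy₂0 hy₂1 hy₃0 hy₃1 hρ₁ hρ₂ hρ₃ hta₁ hta₂ hta₃ hR₁0 hR₂0 hq₂0 hq₂₁ hq₁1
    hq₃0 hq₃1 hQq₃ hbal₁ hbal₂ hx₁ hx₂ hx₃
  have hx1 : x < 1 := by nlinarith
  have f₁ := lawOK_aff_of_subBlobHull hx0 s₁ hy₁0 hq₁0 hq₁1 hρ₁ hta₁ hx₁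
  have f₂ := lawOK_aff_of_subBlobHull hx0 s₂ hy₂0 hq₂0 (lt_of_le_of_lt hq₂₁ hq₁1) hρ₂ hta₂ hx₂
  have f₃ := lawOK_aff_of_subBlobHull hx0 s₃ hy₃0 hq₃0 hq₃1 hρ₃ hta₃ hx₃
  have hLh : ∀ t ∈ [s₃, s₂, s₁], t.LawOK := by
    intro t ht; simp only [List.mem_cons, List.mem_nil_iff, or_false] at ht
    rcases ht with rfl | rfl | rfl
    exacts [f₃.1, f₂.1, f₁.1]
  have hxLh : ∀ t ∈ [s₃, s₂, s₁], x * (t.M : ℝ) ≤ t.q * t.mean := by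
    intro t ht; simp only [List.mem_cons, List.mem_nil_iff, or_false] at ht
    rcases ht with rfl | rfl | rfl
    exacts [f₃.2, f₂.2, f₁.2]
  have hR := sdec_append_reducible hx0 hx1 [s₃, s₂, s₁] hLh hxLh hS Lr hLr hxLr hred
  have hall : ∀ t ∈ Lr ++ [s₃, s₂, s₁], t.LawOK := by
    intro t ht
    rcases List.mem_append.1 ht with h | h
    exacts [hLr t h, hLh t h]
  have hxall : ∀ t ∈ Lr ++ [s₃, s₂, s₁], x * (t.M : ℝ) ≤ t.q * t.mean := by
    intro t ht
    rcases List.mem_append.1 ht with h | h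
    exacts [hxLr t h, hxLh t h]
  exact sdec_append_tame hx0 hx1 (Lr ++ [s₃, s₂, s₁]) hall hxall hR Lt hLt hxLt htame

/-- **THREE COPIES OF ONE DEPTH-1 SIBLING RECORD ON THE BINDER** (`s.ρ ∈ K_y(R)`, `y·s.M ≤ R`, `0 < R`, `0 < s.q < 1`, `0 < x ≤ s.q²·y`):
`SDEC x (ftop [s, s, s]) (flaw [s, s, s])`. [this work] -/
theorem sdec_flaw_three_identical {x : ℝ} (hx0 : 0 < x) (s : Sib) {y R : ℝ} (hy0 : 0 < y) (hy1 : y < 1) (hρ : InBlobHull y R s.M s.ρ)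
    (hta : y * (s.M : ℝ) ≤ R) (hR0 : 0 < R) (hq0 : 0 < s.q) (hq1 : s.q < 1) (hx : x ≤ s.q ^ 2 * y) :
    SDEC x (ftop [s, s, s]) (flaw [s, s, s]) := by
  obtain ⟨_, ρM, _⟩ := hρ.lawFacts hy0.le
  obtain ⟨eF, eT⟩ := flaw_three_eq s s s ρM
  rw [eF, eT]
  exact sdec_three_identical_of_subBlobHull hy0 hy1 hρ hta hR0 hq0 hq1 hx0 hx

/-- **… + REDUCIBLE + TAME SIBLINGS.** [this work] -/
theorem sdec_flaw_identicalTripleCore {x : ℝ} (hx0 : 0 < x) (s : Sib) {y R : ℝ} (hy0 : 0 < y) (hy1 : y < 1) (hρ : InBlobHull y R s.M s.ρ)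
    (hta : y * (s.M : ℝ) ≤ R) (hR0 : 0 < R) (hq0 : 0 < s.q) (hq1 : s.q < 1) (hx : x ≤ s.q ^ 2 * y)
    (Lr : List Sib) (hLr : ∀ s ∈ Lr, s.LawOK) (hxLr : ∀ s ∈ Lr, x * (s.M : ℝ) ≤ s.q * s.mean)
    (hred : ∀ s ∈ Lr, ∃ m : ℝ, InBlobHull x m s.M (gate s.ρ s.q))
    (Lt : List Sib) (hLt : ∀ s ∈ Lt, s.LawOK) (hxLt : ∀ s ∈ Lt, x * (s.M : ℝ) ≤ s.q * s.mean)
    (htame : ∀ s ∈ Lt, ∀ h : ℕ, 1 ≤ h → s.ρ h ≠ 0 → s.q * s.mean ≤ 2 * h ∨ x * ((s.M : ℝ) - h) ≤ s.q * s.mean - h) :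
    SDEC x (ftop (Lt ++ (Lr ++ [s, s, s]))) (flaw (Lt ++ (Lr ++ [s, s, s]))) := by
  have hS := sdec_flaw_three_identical hx0 s hy0 hy1 hρ hta hR0 hq0 hq1 hx
  have hxq : x ≤ s.q * y := by nlinarith [mul_pos hq0 hy0]
  have hx1 : x < 1 := by nlinarith
  have f := lawOK_aff_of_subBlobHull hx0 s hy0 hq0 hq1 hρ hta hxq
  have hLh : ∀ t ∈ [s, s, s], t.LawOK := by
    intro t ht; simp only [List.mem_cons, List.mem_nil_iff, or_false, or_self] at ht
    subst ht; exact f.1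
  have hxLh : ∀ t ∈ [s, s, s], x * (t.M : ℝ) ≤ t.q * t.mean := by
    intro t ht; simp only [List.mem_cons, List.mem_nil_iff, or_false, or_self] at ht
    subst ht; exact f.2
  have hR := sdec_append_reducible hx0 hx1 [s, s, s] hLh hxLh hS Lr hLr hxLr hred
  have hall : ∀ t ∈ Lr ++ [s, s, s], t.LawOK := by
    intro t ht
    rcases List.mem_append.1 ht with h | h
    exacts [hLr t h, hLh t h]
  have hxall : ∀ t ∈ Lr ++ [s, s, s], x * (t.M : ℝ) ≤ t.q * t.mean := by
    intro t ht
    rcases List.mem_append.1 ht with h | h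
    exacts [hxLr t h, hxLh t h]
  exact sdec_append_tame hx0 hx1 (Lr ++ [s, s, s]) hall hxall hR Lt hLt hxLt htame

end LawDec
end Quant
end Summit.CriticalPhenomena.PercolationContinuityZ3.Theorems
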